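import Summits.QuantumFields.Balaban3D.Carriers.Masses

/-!
# Lane `pub-balaban3d` — carrier layer p1 (`Carriers.NonVacuity`): kernel-checked NON-VACUITY WITNESSES for the volume carriers of the tower
# (ruling R-LAMVOL, lane STATUS 2026-08-22T02:07:49Z; AUDIT CHECKLIST «every volume/count carrier field consumed by a leaf ships an example
# with a NONZERO value at a named history»)

A concrete d = 3 instance (`L = 3`, `m = 0`, `K = 1`, `M₁ = 1`, collar profile `Rcol ≡ 0`): the 1-step history `hex` with ONE large-field plaquette
`p₀` at the origin is admissible and non-trivial, the far site `(3,3,3)` lies in its small-field domain `Ω₁(hex)`, hence `|Λ₁(hex)| ≥ 1`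
(`Carriers.Regions.LamVol_pos_of_mem`); together with `LamVol_triv` (`|Λ_k(triv)| = |T^{(k)}|`) this certifies that the (46) volume of the
lane's tower is not identically `0`.  Likewise `|Z₀(hex)| > 0` (the large-field volume of (41) is not identically `0`; it IS `0` at the
trivial history, `ZVol_triv`) and the functional `LF` of (41) over the constructed masses is STRICTLY POSITIVE at every level and field (the
trivial history carries mass `1`).  [folklore] arithmetic on `ZMod 6`; nothing of CMP 102 is asserted.
-/

namespace Summit.QuantumFields.Balaban3D.Carriers

open Literature.MathematicalPhysics.QuantumFieldTheory.Balaban1983to89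

/-- The d = 3 parameters with `L = 3`, `m = 0`, `K = 1`: `T^{(0)}` has 6 sites per direction, `T^{(1)}` has 2. [folklore] -/
abbrev P3ex : Params := ⟨3, 3, 0, 1, by norm_num, by decide⟩

/-- One large-field plaquette at the origin, directions 0, 1. [folklore] -/
def p₀ex : Plaq P3ex 0 := ⟨fun _ => 0, 0, 1, by decide⟩

/-- The 1-step history with `P₀ = {p₀}`. [folklore] -/
noncomputable def hex : Hist P3ex 1 := Hist.snoc (Hist.triv P3ex 0) {p₀ex}

/-- Its last large-field set. [folklore] -/
theorem hex_last : hex.last = {p₀ex} := by simp [hex]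

/-- It is admissible (every 1-step history is). [folklore] -/
theorem hex_admissible (M₁ : ℕ) (Rcol : ℕ → ℕ) : Hist.Admissible M₁ Rcol 1 hex :=
  ⟨trivial, fun _ _ => Set.subset_univ _⟩

/-- It is NOT the trivial history. [folklore] -/
theorem hex_ne_triv : hex ≠ Hist.triv P3ex 1 := by
  intro hh
  have := congrArg Hist.last hh
  rw [hex_last, Hist.last_triv] at this
  exact Finset.singleton_ne_empty _ this

/-- The far site `(3,3,3)` of `T^{(0)}`. [folklore] -/
def xex : Site P3ex 0 := fun _ => (3 : ZMod 6)

/-- The corners of `p₀` have third coordinate `0`. [folklore] -/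
theorem plaqCover_p₀ex_coord2 {x : Site P3ex 0} (hx : x ∈ plaqCover p₀ex) : x 2 = 0 := by
  simp only [plaqCover, Set.mem_setOf_eq, coarsen] at hx
  rcases hx with h | h | h | h <;>
    · have := congrFun h 2
      simpa [p₀ex, Site.shift, Function.update] using this

/-- Sites in the scale-1 big block (`M₁ = 1`) of `xex` have third coordinate of value `≥ 3`. [folklore] -/
theorem coord2_of_block {y : Site P3ex 0} (hy : bigBlockOf 1 1 y = bigBlockOf 1 1 xex) : 3 ≤ (y 2).val := by
  have h2 := congrFun hy 2
  simp only [bigBlockOf, Nat.div_one, coarsen, Function.comp, blockOf, id] at h2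
  have key : ∀ a b : ZMod 6, b = 3 →
      (((a.val / 3 : ℕ) : ZMod (P3ex.sitesPerDir (0 + 1))).val = ((b.val / 3 : ℕ) : ZMod (P3ex.sitesPerDir (0 + 1))).val) →
      3 ≤ a.val := by decide
  exact key (y 2) (xex 2) rfl h2

/-- **`xex ∈ Ω₁(hex)`** for `M₁ = 1`, `Rcol 0 = 0`: the far block avoids the collar of the large plaquette. [folklore] -/
theorem xex_mem_Omega : xex ∈ Omega 1 (fun _ => 0) 1 hex 1 := by
  rw [mem_Omega_one_iff]
  intro y' hy' p hp x hx
  rw [hex_last, Finset.mem_singleton] at hp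
  subst hp
  have hx2 := plaqCover_p₀ex_coord2 hx
  have hy2 := coord2_of_block hy'
  -- sdist 0 x y' = tdist x y' ≥ the coordinate-2 term ≥ 1
  show 0 < Site.tdist (coarsen 0 x) (coarsen 0 y')
  simp only [coarsen, id]
  unfold Site.tdist
  refine lt_of_lt_of_le ?_ (Finset.single_le_sum (f := fun μ => min (x μ - y' μ).val (y' μ - x μ).val)
    (fun _ _ => Nat.zero_le _) (Finset.mem_univ (2 : Fin 3)))
  rw [hx2]
  have hy0 : y' 2 ≠ 0 := by intro h0; rw [h0, ZMod.val_zero] at hy2; omega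
  simp only [zero_sub, sub_zero]
  refine lt_min ?_ ?_
  · rw [Nat.pos_iff_ne_zero, ne_eq, ZMod.val_eq_zero, neg_eq_zero]; exact hy0
  · rw [Nat.pos_iff_ne_zero, ne_eq, ZMod.val_eq_zero]; exact hy0

/-- **NON-VACUITY OF THE (46) VOLUME AT A NON-TRIVIAL ADMISSIBLE HISTORY** (ruling R-LAMVOL / AUDIT CHECKLIST «every volume carrier field ships
an example with a NONZERO value at a named history»): `|Λ₁(hex)| > 0`. [folklore] -/
theorem lamVol_pos_hex : 0 < LamVol 1 (fun _ => 0) 1 hex := LamVol_pos_of_mem 1 (fun _ => 0) hex xex_mem_Omega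

/-- **NON-VACUITY OF THE LARGE-FIELD VOLUME `|Z_j|` OF (41)**: `|Z₀(hex)| > 0` — the corner of the large plaquette lies outside `Ω₁(hex)`
(`not_mem_Omega_succ_of_bad`), so its (scale-0) block meets `Z₀ = Ω₁ᶜ`. [folklore] -/
theorem zVol_pos_hex (M₁ : ℕ) (Rcol : ℕ → ℕ) : 0 < ZVol M₁ Rcol 1 hex 0 := by
  classical
  unfold ZVol
  refine Finset.card_pos.2 ⟨p₀ex.src, ?_⟩
  simp only [Finset.mem_filter, Finset.mem_univ, true_and]
  refine ⟨p₀ex.src, rfl, ?_⟩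
  unfold Zreg
  exact not_mem_Omega_succ_of_bad M₁ Rcol hex (Or.inl ⟨p₀ex, by rw [hex_last]; exact Finset.mem_singleton_self _, Or.inl rfl⟩)

/-- **NON-VACUITY OF THE FUNCTIONAL `LF` OF (41) OVER THE CONSTRUCTED MASSES**: `LF_k(V)[F] ≥ exp(F(triv)) > 0` at every level, field and
exponent (the trivial history has mass `1`, `Carriers.massRec_triv`; so no bound `ρ ≤ LF(…)` is «≤ 0»). [folklore] -/
theorem lf_histWeights3_pos {P : Params} {G : Type} [GaugeGroup G] [MeasurableSpace G] [HaarData G] (M₁ : ℕ) (Rcol : ℕ → ℕ)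
    (εL εS : ℕ → ℝ) (av : ∀ j, Averaging P j G) (k : ℕ) (V : GaugeField P k G) (F : Hist P k → ℝ) :
    0 < LF (histWeights3 M₁ Rcol εL εS av) k V F := by
  refine lt_of_lt_of_le ?_ (mass_triv_mul_exp_le_lf (histWeights3 M₁ Rcol εL εS av) k V F)
  show 0 < massRec M₁ Rcol εL εS av k (Hist.triv P k) V * Real.exp (F (Hist.triv P k))
  rw [massRec_triv, one_mul]
  exact Real.exp_pos _

end Summit.QuantumFields.Balaban3D.Carriers
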